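/-
HONEST FRAMING: certified error envelopes and provably optimal rounding/accumulation schemes for
low-precision formats under stated cost models; every table by two implementations; no hardware
or vendor claims.
-/
import Summits.Ventures.CertifiedArithmetic.LowPrec.OptDemotionRoutingCfgTop

/-!
# The demotion law (Theorem T8), part 11-7: opt's R36 — PHANTOM-POINT CONVEXITY (G) and its reflection dual (H), FOR EVERY `q`

opt gen 16 (HOME pub-lowprec-opt/gen16/R36_GH.md, OPTIMA.md T8 (R36)): two all-`q` families of
o-side-type rows in the single-bit coordinates `x_p = BR_t{0, -p}` (`1 ≤ p ≤ q-1`),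
`x_0 = BR_t{0}`, `u = 2^-q`, `m = 2^-p`, `m' = 2^-p'`, `M = 2^-r`, `M' = 2^-r'`:

  (G) `p < p'`:  `(m - u²)·(x_{p'} - x_0) ≤ (m' - u²)·(x_p - x_0)`
      — the chords from the PHANTOM POINT `(u², x_0)` to the points `(2^-p, x_p)` have non-increasing
      slope in the bit value (R28 gap convexity with the absent endpoint is the shadow `u² → 0`);
  (H) `r' < r`:  `(1 - uM)·x_{r'} ≤ (1 - uM')·x_r + (M' - M)·x_0`
      — two-point R21g (R21g, part 10f `excess_le_ratio`, is the member `M = u²` of H).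

`treeBR_GH` proves both for EVERY `q ≥ 2` and every tree by opt's simultaneous structural induction
(G at a node ⇐ G on the major child, H on the minor child; H ⇐ H on the major, G on the minor:
the bit a minor child receives at position `p` is seen by it at position `q - p`, which swaps the
families); `treeBR_phantomChord` = (G), `treeBR_twoPointRatio` = (H).  The four node-step
certificates are the pure-arithmetic lemmas `gh_G_keep`, `gh_G_give`, `gh_H_keep`, `gh_H_give`
(R36_GH.md §"Proof", multipliers `m m'` resp. `M M'/u` and the relations `u = m M = m' M'`);
options and the two-bit node rule from parts 10h-b/10i-0 (`treeBR_pair_node_ge`,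
`treeBR_pair_node_le`) and 11-2.  opt's validation: 0 violations on 5211 exact tables (q = 5, 6) +
240 000 node pairs; joint cone closure CLOSED q = 4..10; referee Round 76 third route (6162 + 6162
checks, 0 violations).
-/

namespace Summit.Ventures.CertifiedArithmetic.LowPrec.Opt

open Literature.ComputerArithmetic.JeannerodRump2018
open Literature.ComputerArithmetic.JeannerodRump2018.SumTree

section GH

variable {q : ℕ}

/-! ## The four node-step certificates (pure arithmetic) -/

/-- (G), major child keeps the bit `p'`: option `a_{p'} + u b_0`; options `1 + a_p + u b_0 ≤ N_p`,
`1 + a_0 + u b_0 ≤ N_0`; (G) on the major child. -/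
theorem gh_G_keep {u m m' NP N0 aP aP' a0 B0 : ℚ} (hm'u : 0 ≤ m' - u ^ 2) (hmm' : 0 ≤ m - m')
    (o1 : 1 + (aP + u * B0) ≤ NP) (o2 : 1 + (a0 + u * B0) ≤ N0)
    (G : (m - u ^ 2) * aP' ≤ (m' - u ^ 2) * aP + (m - m') * a0) :
    (m - u ^ 2) * (1 + (aP' + u * B0)) ≤ (m' - u ^ 2) * NP + (m - m') * N0 := by
  have f1 := mul_le_mul_of_nonneg_left o1 hm'u
  have f2 := mul_le_mul_of_nonneg_left o2 hmm'
  linear_combination f1 + f2 + G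

/-- (G), minor child receives the bit `p'` (at its position `q - p'`, value `M' = u/m'`): option
`a_0 + m' b(M')`; options `1 + a_0 + m b(M) ≤ N_p`, `1 + a_0 + u b_0 ≤ N_0`; (H) on the minor child
at the positions `q-p' < q-p`, multiplier `m m'`, relations `u = m M = m' M'`. -/
theorem gh_G_give {u m m' M M' NP N0 a0 B0 Bb Bb' : ℚ} (hu1 : u = m * M) (hu2 : u = m' * M')
    (hm : 0 ≤ m) (hm' : 0 ≤ m') (hm'u : 0 ≤ m' - u ^ 2) (hmm' : 0 ≤ m - m')
    (o1 : 1 + (a0 + m * Bb) ≤ NP) (o2 : 1 + (a0 + u * B0) ≤ N0)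
    (H : (1 - u * M) * Bb' ≤ (1 - u * M') * Bb + (M' - M) * B0) :
    (m - u ^ 2) * (1 + (a0 + m' * Bb')) ≤ (m' - u ^ 2) * NP + (m - m') * N0 := by
  have f1 := mul_le_mul_of_nonneg_left o1 hm'u
  have f2 := mul_le_mul_of_nonneg_left o2 hmm'
  have f3 := mul_le_mul_of_nonneg_left H (mul_nonneg hm hm')
  linear_combination f1 + f2 + f3 + (m * u * Bb - m * B0) * hu2 + (m' * B0 - m' * u * Bb') * hu1

/-- (H), major child keeps the bit `r'`: option `a_{r'} + u b_0`; options `1 + a_r + u b_0 ≤ N_r`,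
`1 + a_0 + u b_0 ≤ N_0`; (H) on the major child; slack `(M' - M)(1 - u)(1 + u b_0)`. -/
theorem gh_H_keep {u M M' NR N0 ar ar' a0 B0 : ℚ} (h1 : 0 ≤ 1 - u * M') (h2 : 0 ≤ M' - M)
    (hu : 0 ≤ 1 - u) (hu0 : 0 ≤ u) (hB0 : 0 ≤ B0)
    (o1 : 1 + (ar + u * B0) ≤ NR) (o2 : 1 + (a0 + u * B0) ≤ N0)
    (H : (1 - u * M) * ar' ≤ (1 - u * M') * ar + (M' - M) * a0) :
    (1 - u * M) * (1 + (ar' + u * B0)) ≤ (1 - u * M') * NR + (M' - M) * N0 := by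
  have f1 := mul_le_mul_of_nonneg_left o1 h1
  have f2 := mul_le_mul_of_nonneg_left o2 h2
  have hs : 0 ≤ (M' - M) * (1 - u) * (1 + u * B0) :=
    mul_nonneg (mul_nonneg h2 hu) (by nlinarith)
  linear_combination f1 + f2 + H + hs

/-- (H), minor child receives the bit `r'` (at its position `q - r'`, value `m' = u/M'`): option
`a_0 + M' b(m')`; options `1 + a_0 + M b(m) ≤ N_r` and the MINOR-major option `1 + b_0 + u a_0 ≤ N_0`;
(G) on the minor child at `q-r < q-r'`, multiplier `M M'/u`; slack `(M' - M)(1 - u)`. -/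
theorem gh_H_give {u m m' M M' NR N0 a0 B0 Bt Bt' : ℚ} (hu1 : u = m * M) (hu2 : u = m' * M')
    (hu0 : 0 < u) (hM : 0 ≤ M) (hM' : 0 ≤ M') (h1 : 0 ≤ 1 - u * M') (h2 : 0 ≤ M' - M) (hu : 0 ≤ 1 - u)
    (o1 : 1 + (a0 + M * Bt) ≤ NR) (o2 : 1 + (B0 + u * a0) ≤ N0)
    (G : (m - u ^ 2) * Bt' ≤ (m' - u ^ 2) * Bt + (m - m') * B0) :
    (1 - u * M) * (1 + (a0 + M' * Bt')) ≤ (1 - u * M') * NR + (M' - M) * N0 := by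
  have f1 := mul_le_mul_of_nonneg_left o1 h1
  have f2 := mul_le_mul_of_nonneg_left o2 h2
  -- the b-terms: `M M' · G` is `u ·` what is needed
  have hb0 : 0 ≤ M * M' * ((m' - u ^ 2) * Bt + (m - m') * B0 - (m - u ^ 2) * Bt') :=
    mul_nonneg (mul_nonneg hM hM') (by linarith only [G])
  have hid : u * ((1 - u * M') * M * Bt + (M' - M) * B0 - (1 - u * M) * M' * Bt') =
      M * M' * ((m' - u ^ 2) * Bt + (m - m') * B0 - (m - u ^ 2) * Bt') := by
    linear_combination (M * Bt - M * B0) * hu2 + (M' * B0 - M' * Bt') * hu1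
  have hb : 0 ≤ (1 - u * M') * M * Bt + (M' - M) * B0 - (1 - u * M) * M' * Bt' := by
    have h : u * 0 ≤ u * ((1 - u * M') * M * Bt + (M' - M) * B0 - (1 - u * M) * M' * Bt') := by
      rw [mul_zero, hid]; exact hb0
    exact le_of_mul_le_mul_left h hu0
  have hs : 0 ≤ (M' - M) * (1 - u) := mul_nonneg h2 hu
  linear_combination f1 + f2 + hb + hs

/-! ## The theorem -/

/-- **opt's R36 FOR EVERY `q`**: for `q ≥ 2` and every tree, simultaneously
(G) `(2^-p - u²)·BR{0,-p'} ≤ (2^-p' - u²)·BR{0,-p} + (2^-p - 2^-p')·BR{0}` for `1 ≤ p < p' ≤ q-1`, and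
(H) `(1 - u 2^-r)·BR{0,-r'} ≤ (1 - u 2^-r')·BR{0,-r} + (2^-r' - 2^-r)·BR{0}` for `1 ≤ r' < r ≤ q-1`. -/
theorem treeBR_GH (hq : 2 ≤ q) : ∀ t : SumTree,
    (∀ p p' : ℕ, 1 ≤ p → p < p' → p' + 1 ≤ q →
      ((2 : ℚ) ^ (-(p : ℤ)) - unitRoundoff q ^ 2) * treeBR q t {0, -(p' : ℤ)} ≤
        ((2 : ℚ) ^ (-(p' : ℤ)) - unitRoundoff q ^ 2) * treeBR q t {0, -(p : ℤ)} +
          ((2 : ℚ) ^ (-(p : ℤ)) - (2 : ℚ) ^ (-(p' : ℤ))) * treeBR q t {0}) ∧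
    (∀ r' r : ℕ, 1 ≤ r' → r' < r → r + 1 ≤ q →
      (1 - unitRoundoff q * (2 : ℚ) ^ (-(r : ℤ))) * treeBR q t {0, -(r' : ℤ)} ≤
        (1 - unitRoundoff q * (2 : ℚ) ^ (-(r' : ℤ))) * treeBR q t {0, -(r : ℤ)} +
          ((2 : ℚ) ^ (-(r' : ℤ)) - (2 : ℚ) ^ (-(r : ℤ))) * treeBR q t {0}) := by
  classical
  have hq1 : 1 ≤ q := by omega
  set u := unitRoundoff q with hudef
  have huz : u = (2 : ℚ) ^ (-(q : ℤ)) := unitRoundoff_eq_zpow q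
  have hu0 : 0 < u := by rw [huz]; exact zpow_pos (by norm_num) _
  have hu4 : u ≤ 1 / 4 := by
    rw [huz, show (1 / 4 : ℚ) = (2 : ℚ) ^ (-2 : ℤ) by norm_num]
    exact zpow_le_zpow_right₀ (by norm_num) (by omega)
  have pw : ∀ a b : ℤ, (2 : ℚ) ^ (a + b) = (2 : ℚ) ^ a * (2 : ℚ) ^ b := fun a b =>
    zpow_add₀ (by norm_num) a b
  have n0 : ∀ (X : SumTree) (T : Finset ℤ), 0 ≤ treeBR q X T := fun X T => treeBR_nonneg q X T
  -- scalar facts about a position `1 ≤ i ≤ q - 1`: `2u ≤ 2^-i ≤ ½`, `2^-i · 2^-(q-i) = u`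
  have pos_facts : ∀ i : ℕ, 1 ≤ i → i + 1 ≤ q →
      2 * u ≤ (2 : ℚ) ^ (-(i : ℤ)) ∧ (2 : ℚ) ^ (-(i : ℤ)) ≤ 1 / 2 ∧
        (2 : ℚ) ^ (-(i : ℤ)) * (2 : ℚ) ^ (-(((q - i : ℕ) : ℤ))) = u := by
    intro i hi hiq
    refine ⟨?_, ?_, ?_⟩
    · rw [huz, show (2 : ℚ) * (2 : ℚ) ^ (-(q : ℤ)) = (2 : ℚ) ^ (-(q : ℤ) + 1) by rw [pw]; norm_num; ring]
      exact zpow_le_zpow_right₀ (by norm_num) (by omega)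
    · rw [show (1 / 2 : ℚ) = (2 : ℚ) ^ (-1 : ℤ) by norm_num]
      exact zpow_le_zpow_right₀ (by norm_num) (by omega)
    · rw [← pw, huz]; congr 1; omega
  -- the options of a two-bit coordinate and of `{0}` at a node, both orientations
  have optkeep : ∀ (X Y : SumTree) (i : ℕ), 1 ≤ i → i + 1 ≤ q →
      1 + (treeBR q X {0, -(i : ℤ)} + u * treeBR q Y {0}) ≤ treeBR q (.node X Y) {0, -(i : ℤ)} := by
    intro X Y i hi hiq
    have h := (treeBR_pair_node_ge hq1 X Y hi hiq).1
    rw [treeBR_single_shift Y (-(q : ℤ)), ← huz] at h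
    exact h
  have optgive : ∀ (X Y : SumTree) (i : ℕ), 1 ≤ i → i + 1 ≤ q →
      1 + (treeBR q X {0} + (2 : ℚ) ^ (-(i : ℤ)) * treeBR q Y {0, -(((q - i : ℕ) : ℤ))}) ≤
        treeBR q (.node X Y) {0, -(i : ℤ)} := by
    intro X Y i hi hiq
    have h := (treeBR_pair_node_ge hq1 X Y hi hiq).2
    have e : ({-(i : ℤ), -(q : ℤ)} : Finset ℤ) = {0 + -(i : ℤ), -(((q - i : ℕ) : ℤ)) + -(i : ℤ)} := by
      ext z; simp only [Finset.mem_insert, Finset.mem_singleton]; omega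
    rw [e, treeBR_pair_shift'] at h
    exact h
  have optzero : ∀ (X Y : SumTree), 1 + (treeBR q X {0} + u * treeBR q Y {0}) ≤ treeBR q (.node X Y) {0} := by
    intro X Y
    have h := injected_le_treeBR_node_top hq1 X Y (e₀ := 0) (T := (∅ : Finset ℤ))
      (fun t ht => absurd ht (Finset.notMem_empty t)) (P := ∅) (Finset.empty_subset _)
    rw [zpow_zero, Finset.sdiff_self, Finset.insert_empty, Finset.insert_empty, zero_sub,
      treeBR_single_shift Y (-(q : ℤ)), ← huz] at h
    exact h
  ------------------------------------------------------------------ the induction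
  intro t
  induction t with
  | leaf z => constructor <;> intros <;> simp [treeBR]
  | node A B ihA ihB =>
  obtain ⟨GA, HA⟩ := ihA
  obtain ⟨GB, HB⟩ := ihB
  constructor
  · ---------------------------------------------------------------- (G) at the node
    intro p p' hp hpp' hp'q
    obtain ⟨hmu, hm2, hmM⟩ := pos_facts p hp (by omega)
    obtain ⟨hm'u, hm'2, hm'M'⟩ := pos_facts p' (by omega) hp'q
    set m : ℚ := (2 : ℚ) ^ (-(p : ℤ)) with hmdef
    set m' : ℚ := (2 : ℚ) ^ (-(p' : ℤ)) with hm'def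
    set M : ℚ := (2 : ℚ) ^ (-(((q - p : ℕ) : ℤ))) with hMdef
    set M' : ℚ := (2 : ℚ) ^ (-(((q - p' : ℕ) : ℤ))) with hM'def
    have hm0 : 0 < m := zpow_pos (by norm_num) _
    have hm'0 : 0 < m' := zpow_pos (by norm_num) _
    have hmm' : m' ≤ m := zpow_le_zpow_right₀ (by norm_num) (by omega)
    have hmu2 : 0 < m - u ^ 2 := by nlinarith
    have hm'u2 : 0 ≤ m' - u ^ 2 := by nlinarith
    set NP := treeBR q (.node A B) {0, -(p : ℤ)} with hNP
    set NP' := treeBR q (.node A B) {0, -(p' : ℤ)} with hNP'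
    set N0 := treeBR q (.node A B) {0} with hN0
    -- the bound `R`
    set R : ℚ := ((m' - u ^ 2) * NP + (m - m') * N0) / (m - u ^ 2) - 1 with hRdef
    have toR : ∀ V : ℚ, (m - u ^ 2) * (1 + V) ≤ (m' - u ^ 2) * NP + (m - m') * N0 → V ≤ R := by
      intro V h
      rw [hRdef, le_sub_iff_add_le, le_div_iff₀ hmu2]
      linarith only [h]
    have hNP1 : 1 ≤ NP := by
      have := optkeep A B p hp (by omega); linarith only [this, n0 A {0, -(p : ℤ)}, mul_nonneg hu0.le (n0 B {0})]
    have hN01 : 1 ≤ N0 := by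
      have := optzero A B; linarith only [this, n0 A {0}, mul_nonneg hu0.le (n0 B {0})]
    have hR : 0 ≤ R := by
      refine toR 0 ?_
      have h1 := mul_le_mul_of_nonneg_left hNP1 hm'u2
      have h2 := mul_le_mul_of_nonneg_left hN01 (sub_nonneg.2 hmm')
      linarith only [h1, h2]
    -- the IH rows at the receiving positions `q-p' < q-p` (H on the minor child)
    have hrecv : ∀ Y : SumTree,
        (∀ r' r : ℕ, 1 ≤ r' → r' < r → r + 1 ≤ q →
          (1 - u * (2 : ℚ) ^ (-(r : ℤ))) * treeBR q Y {0, -(r' : ℤ)} ≤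
            (1 - u * (2 : ℚ) ^ (-(r' : ℤ))) * treeBR q Y {0, -(r : ℤ)} +
              ((2 : ℚ) ^ (-(r' : ℤ)) - (2 : ℚ) ^ (-(r : ℤ))) * treeBR q Y {0}) →
        (1 - u * M) * treeBR q Y {0, -(((q - p' : ℕ) : ℤ))} ≤
          (1 - u * M') * treeBR q Y {0, -(((q - p : ℕ) : ℤ))} + (M' - M) * treeBR q Y {0} :=
      fun Y HY => HY (q - p') (q - p) (by omega) (by omega) (by omega)
    -- one orientation: `X` major
    have core : ∀ (X Y : SumTree),
        (m - u ^ 2) * treeBR q X {0, -(p' : ℤ)} ≤ (m' - u ^ 2) * treeBR q X {0, -(p : ℤ)} + (m - m') * treeBR q X {0} →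
        (1 - u * M) * treeBR q Y {0, -(((q - p' : ℕ) : ℤ))} ≤
          (1 - u * M') * treeBR q Y {0, -(((q - p : ℕ) : ℤ))} + (M' - M) * treeBR q Y {0} →
        1 + (treeBR q X {0, -(p : ℤ)} + u * treeBR q Y {0}) ≤ NP →
        1 + (treeBR q X {0} + m * treeBR q Y {0, -(((q - p : ℕ) : ℤ))}) ≤ NP →
        1 + (treeBR q X {0} + u * treeBR q Y {0}) ≤ N0 →
        treeBR q X {0, -(p' : ℤ)} + treeBR q Y {-(q : ℤ)} ≤ R ∧
          treeBR q X {0} + treeBR q Y {-(p' : ℤ), -(q : ℤ)} ≤ R := by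
      intro X Y GX HY ok og oz
      constructor
      · rw [treeBR_single_shift, ← huz]
        exact toR _ (gh_G_keep hm'u2 (sub_nonneg.2 hmm') ok oz GX)
      · have e : ({-(p' : ℤ), -(q : ℤ)} : Finset ℤ) = {0 + -(p' : ℤ), -(((q - p' : ℕ) : ℤ)) + -(p' : ℤ)} := by
          ext z; simp only [Finset.mem_insert, Finset.mem_singleton]; omega
        rw [e, treeBR_pair_shift']
        exact toR _ (gh_G_give hmM.symm hm'M'.symm hm0.le hm'0.le hm'u2 (sub_nonneg.2 hmm') og oz HY)
    have hab := core A B (GA p p' hp hpp' hp'q) (hrecv B HB) (optkeep A B p hp (by omega))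
      (optgive A B p hp (by omega)) (optzero A B)
    have hba := core B A (GB p p' hp hpp' hp'q) (hrecv A HA)
      (by have h := optkeep B A p hp (by omega); rw [treeBR_node_comm A B] at h; exact h)
      (by have h := optgive B A p hp (by omega); rw [treeBR_node_comm A B] at h; exact h)
      (by have h := optzero B A; rw [treeBR_node_comm A B] at h; exact h)
    have key := treeBR_pair_node_le hq1 A B (i := p') (by omega) hp'q hR
      (max_le (max_le hab.1 hab.2) (max_le hba.1 hba.2))
    -- `NP' ≤ 1 + R` is the claim
    have e : (m - u ^ 2) * (1 + R) = (m' - u ^ 2) * NP + (m - m') * N0 := by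
      rw [hRdef]; field_simp; ring
    have := mul_le_mul_of_nonneg_left key hmu2.le
    rw [e] at this
    exact this
  · ---------------------------------------------------------------- (H) at the node
    intro r' r hr' hrr' hrq
    obtain ⟨hMu, hM2, hMm⟩ := pos_facts r (by omega) hrq
    obtain ⟨hM'u, hM'2, hM'm'⟩ := pos_facts r' hr' (by omega)
    set M : ℚ := (2 : ℚ) ^ (-(r : ℤ)) with hMdef
    set M' : ℚ := (2 : ℚ) ^ (-(r' : ℤ)) with hM'def
    set m : ℚ := (2 : ℚ) ^ (-(((q - r : ℕ) : ℤ))) with hmdef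
    set m' : ℚ := (2 : ℚ) ^ (-(((q - r' : ℕ) : ℤ))) with hm'def
    have hM0 : 0 < M := zpow_pos (by norm_num) _
    have hM'0 : 0 < M' := zpow_pos (by norm_num) _
    have hMM' : M ≤ M' := zpow_le_zpow_right₀ (by norm_num) (by omega)
    have h1M : 0 < 1 - u * M := by nlinarith
    have h1M' : 0 ≤ 1 - u * M' := by nlinarith
    have hu1 : 0 ≤ 1 - u := by linarith only [hu4]
    set NR := treeBR q (.node A B) {0, -(r : ℤ)} with hNR
    set NR' := treeBR q (.node A B) {0, -(r' : ℤ)} with hNR'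
    set N0 := treeBR q (.node A B) {0} with hN0
    set R : ℚ := ((1 - u * M') * NR + (M' - M) * N0) / (1 - u * M) - 1 with hRdef
    have toR : ∀ V : ℚ, (1 - u * M) * (1 + V) ≤ (1 - u * M') * NR + (M' - M) * N0 → V ≤ R := by
      intro V h
      rw [hRdef, le_sub_iff_add_le, le_div_iff₀ h1M]
      linarith only [h]
    have hNR1 : 1 ≤ NR := by
      have := optkeep A B r (by omega) hrq; linarith only [this, n0 A {0, -(r : ℤ)}, mul_nonneg hu0.le (n0 B {0})]
    have hN01 : 1 ≤ N0 := by
      have := optzero A B; linarith only [this, n0 A {0}, mul_nonneg hu0.le (n0 B {0})]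
    have hR : 0 ≤ R := by
      refine toR 0 ?_
      have h1 := mul_le_mul_of_nonneg_left hNR1 h1M'
      have h2 := mul_le_mul_of_nonneg_left hN01 (sub_nonneg.2 hMM')
      nlinarith only [h1, h2, hu1, sub_nonneg.2 hMM', hu0]
    -- the IH rows at the receiving positions `q-r < q-r'` (G on the minor child)
    have hrecv : ∀ Y : SumTree,
        (∀ p p' : ℕ, 1 ≤ p → p < p' → p' + 1 ≤ q →
          ((2 : ℚ) ^ (-(p : ℤ)) - u ^ 2) * treeBR q Y {0, -(p' : ℤ)} ≤
            ((2 : ℚ) ^ (-(p' : ℤ)) - u ^ 2) * treeBR q Y {0, -(p : ℤ)} +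
              ((2 : ℚ) ^ (-(p : ℤ)) - (2 : ℚ) ^ (-(p' : ℤ))) * treeBR q Y {0}) →
        (m - u ^ 2) * treeBR q Y {0, -(((q - r' : ℕ) : ℤ))} ≤
          (m' - u ^ 2) * treeBR q Y {0, -(((q - r : ℕ) : ℤ))} + (m - m') * treeBR q Y {0} :=
      fun Y GY => GY (q - r) (q - r') (by omega) (by omega) (by omega)
    have core : ∀ (X Y : SumTree),
        (1 - u * M) * treeBR q X {0, -(r' : ℤ)} ≤ (1 - u * M') * treeBR q X {0, -(r : ℤ)} + (M' - M) * treeBR q X {0} →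
        (m - u ^ 2) * treeBR q Y {0, -(((q - r' : ℕ) : ℤ))} ≤
          (m' - u ^ 2) * treeBR q Y {0, -(((q - r : ℕ) : ℤ))} + (m - m') * treeBR q Y {0} →
        1 + (treeBR q X {0, -(r : ℤ)} + u * treeBR q Y {0}) ≤ NR →
        1 + (treeBR q X {0} + M * treeBR q Y {0, -(((q - r : ℕ) : ℤ))}) ≤ NR →
        1 + (treeBR q X {0} + u * treeBR q Y {0}) ≤ N0 →
        1 + (treeBR q Y {0} + u * treeBR q X {0}) ≤ N0 →
        treeBR q X {0, -(r' : ℤ)} + treeBR q Y {-(q : ℤ)} ≤ R ∧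
          treeBR q X {0} + treeBR q Y {-(r' : ℤ), -(q : ℤ)} ≤ R := by
      intro X Y HX GY ok og oz oz'
      constructor
      · rw [treeBR_single_shift, ← huz]
        exact toR _ (gh_H_keep h1M' (sub_nonneg.2 hMM') hu1 hu0.le (n0 Y {0}) ok oz HX)
      · have e : ({-(r' : ℤ), -(q : ℤ)} : Finset ℤ) = {0 + -(r' : ℤ), -(((q - r' : ℕ) : ℤ)) + -(r' : ℤ)} := by
          ext z; simp only [Finset.mem_insert, Finset.mem_singleton]; omega
        rw [e, treeBR_pair_shift']
        exact toR _ (gh_H_give (m := m) (m' := m') (by rw [mul_comm]; exact hMm.symm)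
          (by rw [mul_comm]; exact hM'm'.symm) hu0 hM0.le hM'0.le h1M' (sub_nonneg.2 hMM') hu1 og oz' GY)
    have hab := core A B (HA r' r hr' hrr' hrq) (hrecv B GB) (optkeep A B r (by omega) hrq)
      (optgive A B r (by omega) hrq) (optzero A B) (by have h := optzero B A; rw [treeBR_node_comm A B] at h; exact h)
    have hba := core B A (HB r' r hr' hrr' hrq) (hrecv A GA)
      (by have h := optkeep B A r (by omega) hrq; rw [treeBR_node_comm A B] at h; exact h)
      (by have h := optgive B A r (by omega) hrq; rw [treeBR_node_comm A B] at h; exact h)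
      (by have h := optzero B A; rw [treeBR_node_comm A B] at h; exact h) (optzero A B)
    have key := treeBR_pair_node_le hq1 A B (i := r') hr' (by omega) hR
      (max_le (max_le hab.1 hab.2) (max_le hba.1 hba.2))
    have e : (1 - u * M) * (1 + R) = (1 - u * M') * NR + (M' - M) * N0 := by
      rw [hRdef]; field_simp; ring
    have := mul_le_mul_of_nonneg_left key h1M.le
    rw [e] at this
    exact this

/-- **(G) PHANTOM-POINT CONVEXITY (opt R36), every `q ≥ 2`, every tree**: for `1 ≤ p < p' ≤ q-1`,
`(2^-p - u²)·(BR{0,-p'} - BR{0}) ≤ (2^-p' - u²)·(BR{0,-p} - BR{0})`. -/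
theorem treeBR_phantomChord (hq : 2 ≤ q) {p p' : ℕ} (hp : 1 ≤ p) (hpp' : p < p') (hp'q : p' + 1 ≤ q)
    (t : SumTree) :
    ((2 : ℚ) ^ (-(p : ℤ)) - unitRoundoff q ^ 2) * (treeBR q t {0, -(p' : ℤ)} - treeBR q t {0}) ≤
      ((2 : ℚ) ^ (-(p' : ℤ)) - unitRoundoff q ^ 2) * (treeBR q t {0, -(p : ℤ)} - treeBR q t {0}) := by
  have h := (treeBR_GH hq t).1 p p' hp hpp' hp'q
  linarith only [h]

/-- **(H) TWO-POINT R21g (opt R36), every `q ≥ 2`, every tree**: for `1 ≤ r' < r ≤ q-1`,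
`(1 - u·2^-r)·BR{0,-r'} ≤ (1 - u·2^-r')·BR{0,-r} + (2^-r' - 2^-r)·BR{0}`. -/
theorem treeBR_twoPointRatio (hq : 2 ≤ q) {r' r : ℕ} (hr' : 1 ≤ r') (hrr' : r' < r) (hrq : r + 1 ≤ q)
    (t : SumTree) :
    (1 - unitRoundoff q * (2 : ℚ) ^ (-(r : ℤ))) * treeBR q t {0, -(r' : ℤ)} ≤
      (1 - unitRoundoff q * (2 : ℚ) ^ (-(r' : ℤ))) * treeBR q t {0, -(r : ℤ)} +
        ((2 : ℚ) ^ (-(r' : ℤ)) - (2 : ℚ) ^ (-(r : ℤ))) * treeBR q t {0} :=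
  (treeBR_GH hq t).2 r' r hr' hrr' hrq

end GH

end Summit.Ventures.CertifiedArithmetic.LowPrec.Opt
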